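import Literature.Computability.Complexity.Classes
import Literature.Computability.Complexity.Nondeterministic
import Literature.Computability.Complexity.Oracle
import HarnessLib

-- provenance: harness21/H21/H21/Prelude/CplxCore/PolyHierarchy.lean @ 6de89a0 (interim HEAD d8f2665); M5 mechanical rewrite
/-!
# The polynomial hierarchy (trunk T-CPLX-CORE, outline C10; notion `class_PH`)

We define the levels `Σₖᵖ`, `Πₖᵖ`, `Δₖᵖ` of the polynomial-time hierarchy and `PH = ⋃ₖ Σₖᵖ`
by *iterating class operators* (outline D3): starting from a base class `C`,

* `sigmaP C 0 = C`, `sigmaP C (k+1) = polyExists (co (sigmaP C k))` (`Σₖ₊₁ = ∃ᵖ·Πₖ`);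
* `piP C k = co (sigmaP C k)`;
* `deltaP C 0 = C`, `deltaP C (k+1) = PRelClass (sigmaP C k)` (`Δₖ₊₁ = P^{Σₖ}`).

The unrelativised hierarchy is the case `C = P` (`SigmaP`, `PiP`, `DeltaP`, `PH`); the hierarchy
relative to an oracle `O` is the case `C = PRel O` (`SigmaPRel`, `PiPRel`, `PHRel`), following
Baker–Gill–Solovay.

Sources: Meyer–Stockmeyer 1972 and Stockmeyer 1976, "The polynomial-time hierarchy" (Def. of
`Σₖᵖ, Πₖᵖ, Δₖᵖ`); Arora–Barak 2009, *Computational Complexity*, Def. 5.3, Remark 5.8 (quantifier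
characterisation `Σₖ₊₁ = ∃ᵖ Πₖ`), §5.5 (oracle characterisation `Δₖ₊₁ = P^{Σₖ}`);
Baker–Gill–Solovay 1975 (relativised classes).

Design choices. The quantifier form (Arora–Barak Def. 5.3, via the operators `polyExists`/`co` of
`Nondeterministic.lean`/`Classes.lean`) is taken as the definition of `Σₖ`; the equivalent oracle
form `Σₖ₊₁ = NP^{Σₖ}` (Arora–Barak Thm. 5.12) is left to statement files. `Δₖ` uses the class-oracle
operator `PRelClass` of `Oracle.lean`. With base `P`, level one is `polyExists (co P)`, which equals
`NP = polyExists P` only through `co_P : co P = P` (`SigmaP_one`, proved from the sorried `co_P`). Mathlib has no complexity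
classes beyond `Turing.TM2ComputableInPolyTime` (grep: no `PH`, `SigmaP`, polynomial hierarchy), so
nothing is reused. `PH ⊆ PSPACE` and the collapse theorems live in statement files (prelude acyclic).
-/

namespace Literature.Computability.Complexity

open _root_.Computability

/-! ### Iterated operators over a base class -/

/-- The `Σ`-levels of the polynomial hierarchy over a base class `C`:
`sigmaP C 0 = C` and `sigmaP C (k+1) = polyExists (co (sigmaP C k))`, i.e. `Σₖ₊₁ = ∃ᵖ·Πₖ`.
With `C = P` this is `Σₖᵖ`; with `C = P^O` it is `Σₖᵖ,ᴼ`.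
[Stockmeyer 1976, §3; Arora–Barak 2009, Def. 5.3 and Remark 5.8] [cite: Stockmeyer1976, §3] -/
noncomputable def sigmaP (C : Set (Language Bool)) : ℕ → Set (Language Bool)
  | 0 => C
  | k + 1 => polyExists (co (sigmaP C k))

/-- `sigmaP C 0 = C` (definitional). [Arora–Barak 2009, Def. 5.3] [cite: AroraBarak2009, Def. 5.3] -/
@[simp] theorem sigmaP_zero (C : Set (Language Bool)) : sigmaP C 0 = C :=
  rfl

/-- `sigmaP C (k+1) = polyExists (co (sigmaP C k))` (definitional): `Σₖ₊₁ = ∃ᵖ·Πₖ`.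
[Arora–Barak 2009, Def. 5.3 and Remark 5.8] [cite: AroraBarak2009, Def. 5.3 and Remark 5.8] -/
@[simp] theorem sigmaP_succ (C : Set (Language Bool)) (k : ℕ) :
    sigmaP C (k + 1) = polyExists (co (sigmaP C k)) :=
  rfl

/-- The `Π`-levels over a base class `C`: `piP C k = co (sigmaP C k)`, i.e. `Πₖ = coΣₖ`.
[Stockmeyer 1976, §3; Arora–Barak 2009, Def. 5.3] [cite: Stockmeyer1976, §3] -/
noncomputable def piP (C : Set (Language Bool)) (k : ℕ) : Set (Language Bool) :=
  co (sigmaP C k)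

/-- The `Δ`-levels over a base class `C`: `deltaP C 0 = C` and
`deltaP C (k+1) = PRelClass (sigmaP C k)`, i.e. `Δₖ₊₁ = P^{Σₖ}` (polynomial-time Turing access
to a `Σₖ` oracle). [Stockmeyer 1976, §3; Arora–Barak 2009, §5.5] [cite: Stockmeyer1976, §3] -/
noncomputable def deltaP (C : Set (Language Bool)) : ℕ → Set (Language Bool)
  | 0 => C
  | k + 1 => PRelClass (sigmaP C k)

/-- `deltaP C 0 = C` (definitional). [Stockmeyer 1976, §3] [cite: Stockmeyer1976, §3] -/
@[simp] theorem deltaP_zero (C : Set (Language Bool)) : deltaP C 0 = C :=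
  rfl

/-- `deltaP C (k+1) = PRelClass (sigmaP C k)` (definitional): `Δₖ₊₁ = P^{Σₖ}`.
[Stockmeyer 1976, §3; Arora–Barak 2009, §5.5] [cite: Stockmeyer1976, §3] -/
@[simp] theorem deltaP_succ (C : Set (Language Bool)) (k : ℕ) :
    deltaP C (k + 1) = PRelClass (sigmaP C k) :=
  rfl

/-- `sigmaP` is monotone in the base class. [Arora–Barak 2009, Def. 5.3] [cite: AroraBarak2009, Def. 5.3] -/
theorem sigmaP_mono {C D : Set (Language Bool)} (h : C ⊆ D) (k : ℕ) : sigmaP C k ⊆ sigmaP D k := by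
  induction k with
  | zero => exact h
  | succ k ih => exact polyExists_mono (co_mono ih)

/-! ### The unrelativised hierarchy -/

/-- The class `Σₖᵖ = sigmaP P k` (`Σ₀ᵖ = P`, `Σ₁ᵖ = NP`, `Σₖ₊₁ᵖ = ∃ᵖ·Πₖᵖ`).
[Stockmeyer 1976, §3; Arora–Barak 2009, Def. 5.3] [cite: Stockmeyer1976, §3] -/
noncomputable def SigmaP (k : ℕ) : Set (Language Bool) :=
  sigmaP Classes.P k

/-- The class `Πₖᵖ = coΣₖᵖ`. [Stockmeyer 1976, §3; Arora–Barak 2009, Def. 5.3] [cite: Stockmeyer1976, §3] -/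
noncomputable def PiP (k : ℕ) : Set (Language Bool) :=
  piP Classes.P k

/-- The class `Δₖᵖ` (`Δ₀ᵖ = P`, `Δₖ₊₁ᵖ = P^{Σₖᵖ}`). [Stockmeyer 1976, §3; Arora–Barak 2009, §5.5] [cite: Stockmeyer1976, §3] -/
noncomputable def DeltaP (k : ℕ) : Set (Language Bool) :=
  deltaP Classes.P k

/-- The polynomial hierarchy `PH = ⋃ₖ Σₖᵖ`. [Stockmeyer 1976, §3; Arora–Barak 2009, Def. 5.3] [cite: Stockmeyer1976, §3] -/
noncomputable def PH : Set (Language Bool) :=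
  ⋃ k, SigmaP k

/-! ### The relativised hierarchy -/

/-- The class `Σₖᵖ,ᴼ = sigmaP (P^O) k` relative to an oracle `O`.
[Baker–Gill–Solovay 1975, §1; Arora–Barak 2009, §5.5] [cite: BakerGillSolovay1975, §1] -/
noncomputable def SigmaPRel (O : Oracle) (k : ℕ) : Set (Language Bool) :=
  sigmaP (PRel O) k

/-- The class `Πₖᵖ,ᴼ = coΣₖᵖ,ᴼ` relative to an oracle `O`.
[Baker–Gill–Solovay 1975, §1; Arora–Barak 2009, §5.5] [cite: BakerGillSolovay1975, §1] -/
noncomputable def PiPRel (O : Oracle) (k : ℕ) : Set (Language Bool) :=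
  piP (PRel O) k

/-- The relativised polynomial hierarchy `PH^O = ⋃ₖ Σₖᵖ,ᴼ`.
[Baker–Gill–Solovay 1975, §1; Arora–Barak 2009, §5.5] [cite: BakerGillSolovay1975, §1] -/
noncomputable def PHRel (O : Oracle) : Set (Language Bool) :=
  ⋃ k, SigmaPRel O k

/-! ### Basic API -/

/-- `Σ₀ᵖ = P` (definitional). [Arora–Barak 2009, Def. 5.3] [cite: AroraBarak2009, Def. 5.3] -/
@[simp] theorem SigmaP_zero : SigmaP 0 = Classes.P :=
  rfl

/-- `Σₖ₊₁ᵖ = ∃ᵖ·Πₖᵖ` (definitional). [Arora–Barak 2009, Def. 5.3 and Remark 5.8] [cite: AroraBarak2009, Def. 5.3 and Remark 5.8] -/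
theorem SigmaP_succ (k : ℕ) : SigmaP (k + 1) = polyExists (PiP k) :=
  rfl

/-- `Πₖᵖ = coΣₖᵖ` (definitional). [Arora–Barak 2009, Def. 5.3] [cite: AroraBarak2009, Def. 5.3] -/
theorem PiP_eq_co (k : ℕ) : PiP k = co (SigmaP k) :=
  rfl

/-- `Σ₁ᵖ = NP`. By definition `Σ₁ᵖ = polyExists (co P)`, so this uses `co P = P` (`co_P`).
[Stockmeyer 1976, §3; Arora–Barak 2009, Def. 5.3 ("Σ₁ᵖ = NP")] [cite: Stockmeyer1976, §3] -/
def SigmaP_one : Prop :=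
  SigmaP 1 = Nondeterministic.NP

/- interim proof relied on results that are now named facts (D-0014); demoted to a fact by the M5 import, proof preserved:
:= by
  simp only [SigmaP, sigmaP_succ, sigmaP_zero, co_P, NP]
-/

/-- `Π₁ᵖ = coNP`. [Stockmeyer 1976, §3; Arora–Barak 2009, Def. 5.3 ("Π₁ᵖ = coNP")] [cite: Stockmeyer1976, §3] -/
def PiP_one : Prop :=
  PiP 1 = coNP

/- interim proof relied on results that are now named facts (D-0014); demoted to a fact by the M5 import, proof preserved:
:= by
  rw [coNP, ← SigmaP_one]; rfl
-/

/-- `Σₖᵖ ⊆ Σₖ₊₁ᵖ` (ignore the extra quantifier). [Stockmeyer 1976, §3; Arora–Barak 2009, §5.2] [cite: Stockmeyer1976, §3] -/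
def SigmaP_subset_succ : Prop :=
  ∀ (k : ℕ),
    SigmaP k ⊆ SigmaP (k + 1)

/-- `Πₖᵖ ⊆ Σₖ₊₁ᵖ` (an existential quantifier over a dummy witness).
[Stockmeyer 1976, §3; Arora–Barak 2009, §5.2] [cite: Stockmeyer1976, §3] -/
def PiP_subset_SigmaP_succ : Prop :=
  ∀ (k : ℕ),
    PiP k ⊆ SigmaP (k + 1)

/-- `Σₖᵖ ⊆ PH`. [Arora–Barak 2009, Def. 5.3] [cite: AroraBarak2009, Def. 5.3] -/
theorem SigmaP_subset_PH (k : ℕ) : SigmaP k ⊆ PH :=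
  Set.subset_iUnion SigmaP k

/-- `NP ⊆ PH` (as `NP = Σ₁ᵖ`). [Arora–Barak 2009, Def. 5.3] [cite: AroraBarak2009, Def. 5.3] -/
def NP_subset_PH : Prop :=
  Nondeterministic.NP ⊆ PH

/- interim proof relied on results that are now named facts (D-0014); demoted to a fact by the M5 import, proof preserved:
:=
  SigmaP_one ▸ SigmaP_subset_PH 1
-/

/-- `P ⊆ PH` (as `P = Σ₀ᵖ`). [Arora–Barak 2009, Def. 5.3] [cite: AroraBarak2009, Def. 5.3] -/
theorem P_subset_PH : Classes.P ⊆ PH :=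
  SigmaP_subset_PH 0

/-- `Σₖᵖ,ᴼ ⊆ PH^O`. [Baker–Gill–Solovay 1975, §1] [cite: BakerGillSolovay1975, §1] -/
theorem SigmaPRel_subset_PHRel (O : Oracle) (k : ℕ) : SigmaPRel O k ⊆ PHRel O :=
  Set.subset_iUnion (SigmaPRel O) k

/-- Relativising to the empty oracle changes nothing: `PH^∅ = PH` (from `P^∅ = P`,
`PRel_empty`). [Baker–Gill–Solovay 1975, §1] [cite: BakerGillSolovay1975, §1] -/
def PHRel_ofLanguage_empty : Prop :=
  PHRel (Oracle.ofLanguage (∅ : Set (List Bool))) = PH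

/- interim proof relied on results that are now named facts (D-0014); demoted to a fact by the M5 import, proof preserved:
:= by
  change PHRel Oracle.empty = PH
  simp only [PHRel, SigmaPRel, PRel_empty, PH, SigmaP]
-/

end Literature.Computability.Complexity
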